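import Summits.CriticalPhenomena.PercolationContinuityZ3.Theorems.Transplant.SkelNegBParamsReachT
import Summits.CriticalPhenomena.PercolationContinuityZ3.Theorems.Transplant.SkelNegBChoiceAllTA
import HarnessLib

/-!
# N1 params, chain of record `NegB`, part ReachT-A — the (ζ′) twin of parts ReachFC/ReachT at `A := Aof κ = 20·K` ((C) column): positivity of the lattice record `prFA`
# (`prFA_pos`), THE (C) CORRIDOR's FRAME-CHANGE NUMBERS AT `b0TA := r/4` — **`NegB.aWTA/BxTA/bLTA`** with `ha_TA/hBx_TA/hb_TA` —, the sizes **(P3-A) `aWTA ≤ 24·Kq·n_L`**,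
# **(P4-A) `U·(bLTA + 1) ≤ 12·Kq·Δ`**, **(P5-A) `r_i ≤ 4·b0TA_i`**, and the commensurability **`hsc_RA : c_i·A·(K·Δ) = r_i·D_A`** (stmt-g16 2026-08-22; NEG-SCOPE §B.19 (ζ′))
Sizes at `A`: `c_i = A·s_i`, `D_A = A²·Δ`, `b0TA_i = 10·Kq·s_i` give `aW = ⌊(s₁n(10Kq·s₀+1) + s₀|v_L|(10Kq·s₁+1))/(s₀s₁)⌋ + 1 ≤ 11·Kq·(n + |v_L|) + 1 ≤ 24·Kq·n`,
`Bx = ⌊Δ(10Kq·s₁+1)/s₁⌋ + 1 ≤ 11·Kq·Δ + 1`, `U(bL + 1) ≤ Bx + 2U ≤ 12·Kq·Δ` (`2U + 1 ≤ Δ`) — the `×Kq` of FEASIBILITY §ζ′ (the arrival box is `10·Kq` strides).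
LOCATED for the (C) twins (p5 lineage): the record's generic corridor lemmas (`SkelPhiNegReachFinal/ReadB/ReadC/RoomsAB/RoomsC`) take `hsc0/hsc1 : c·A·(40·Δ) = r·D` with the LITERAL
`40` = strides per `r` today; under (ζ′) `r = K` strides, so the identity of record is `c·A·(K·Δ) = r·D_A` (`hsc_RA`; `K = 40·Kq`) — the generic lemmas' `40` becomes a parameter `k`
with `r = k·(cells per stride)`.
builds on p205010 (kernel theorem, internal audit signed; external expert review pending) — nothing in this file uses p205010; NOTHING is claimed about the node
`SamePDropOfSkeletonNeg₁` (OPEN).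
Lane `prim-bschramm-*`, seat `prim-bschramm-stmt` (gen 16); helper file (`--supports stmt-CriticalPhenomena-4575 --as helper`); ledger HOME/prim-bschramm-stmt/NEG-PARAMS.md.
* §1 **`prFA_pos`**, **`aWTA/BxTA/bLTA`**, `ha_TA/hBx_TA/hb_TA`, `aWTA_nonneg`, `r_le_four_b0TA`, **`hsc_RA`**; §2 **`aWTA_le`** (P3-A), **`U_bLTA_le`** (P4-A).
[cite: KozmaNitzan2024, §4 Lemma 12 (pp. 23–25)] [cite: MartineauTassion2017, §4.3 Lemma 4.2]
-/

noncomputable section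

open scoped Classical

namespace Summit.CriticalPhenomena.PercolationContinuityZ3.Theorems.Transplant

namespace PlanarSkeletonNeg

namespace NegB

open Literature.Probability.Percolation Literature.Probability.LatticeModels SimpleGraph
open SkelConc (Consts)
open Skelφ.StepI (DataN)
open TwoAxis.Para (modulus)
open Skelφ (shearUnit shearUnit_pos)
open Neg

/-! ## §1 The frame-change numbers at `b0TA` -/

section Values

variable (κ : Consts) {V : Type} [DecidableEq V] [Countable V] {G : SimpleGraph V} [G.LocallyFinite] (Φ : PlanarSkeletonNeg G) (t : V)
  (p : unitInterval) (D : DataN V) (g f : ℕ)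

/-- **Positivity of the (ζ′) lattice record** under the numeric long clause: `0 < A`, `1 ≤ n`, `0 < modulus`, `0 < c₀`, `0 < c₁`, `0 < D_A`. [folklore] -/
theorem prFA_pos (hN : EqNumL κ Φ t p D g f) :
    0 < (prFA κ Φ t p D g f).A ∧ 1 ≤ (prFA κ Φ t p D g f).n ∧ 0 < modulus (prFA κ Φ t p D g f).n (prFA κ Φ t p D g f).h (prFA κ Φ t p D g f).vα (prFA κ Φ t p D g f).vβ ∧
      0 < (prFA κ Φ t p D g f).c₀ ∧ 0 < (prFA κ Φ t p D g f).c₁ ∧ 0 < (prFA κ Φ t p D g f).D := by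
  obtain ⟨hn1, hℓ1⟩ := one_le_of_eqNumL κ Φ t p D g f hN
  obtain ⟨hA, hn, hh, hvα, hvβ, -, -, hD⟩ := prFA_fields κ Φ t p D g f
  have hm : 0 < modulus (prFA κ Φ t p D g f).n (prFA κ Φ t p D g f).h (prFA κ Φ t p D g f).vα (prFA κ Φ t p D g f).vβ := by
    rw [hn, hh, hvα, hvβ]; exact Skelφ.NegPrm.modulus_vβOf_pos hn1 hℓ1 _ _
  refine ⟨by rw [hA]; exact (Aof_pos κ).1, by rw [hn]; exact_mod_cast hn1, hm, (prFA_c_pos κ Φ t p D g f).1, (prFA_c_pos κ Φ t p D g f).2, ?_⟩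
  rw [hD]; exact Skelφ.NegPrm.DofA_pos (Aof_pos κ).2 hn1 hℓ1 _ _

/-- **`aWTA := ⌈D_A·(c₁·n·(b0TA₀+1) + c₀·|v_α|·(b0TA₁+1)) / (c₀c₁·A·Δ)⌉`** (floor + 1). [this work] -/
def aWTA : ℤ :=
  (prFA κ Φ t p D g f).D * ((prFA κ Φ t p D g f).c₁ * (prFA κ Φ t p D g f).n * ((b0TA κ Φ t p D g f 0 : ℤ) + 1) +
      (prFA κ Φ t p D g f).c₀ * |(prFA κ Φ t p D g f).vα| * ((b0TA κ Φ t p D g f 1 : ℤ) + 1)) /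
    ((prFA κ Φ t p D g f).c₀ * (prFA κ Φ t p D g f).c₁ * (prFA κ Φ t p D g f).A *
      modulus (prFA κ Φ t p D g f).n (prFA κ Φ t p D g f).h (prFA κ Φ t p D g f).vα (prFA κ Φ t p D g f).vβ) + 1

/-- **`BxTA := ⌈D_A·(b0TA₁+1) / (c₁·A)⌉`** (floor + 1). [this work] -/
def BxTA : ℤ := (prFA κ Φ t p D g f).D * ((b0TA κ Φ t p D g f 1 : ℤ) + 1) / ((prFA κ Φ t p D g f).c₁ * (prFA κ Φ t p D g f).A) + 1

/-- **`bLTA := BxTA / U + 1`** (`U = n_L + |h_L|`). [this work] -/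
def bLTA : ℤ := BxTA κ Φ t p D g f / (shearUnit (nL κ Φ t p D g f) (hL κ Φ t p D g f) : ℤ) + 1

/-- **`ha`** at `K := b0TA`, `a := aWTA`. [folklore] -/
theorem ha_TA (hN : EqNumL κ Φ t p D g f) :
    (prFA κ Φ t p D g f).D * ((prFA κ Φ t p D g f).c₁ * ((prFA κ Φ t p D g f).n : ℤ) * ((b0TA κ Φ t p D g f 0 : ℤ) + 1) +
        (prFA κ Φ t p D g f).c₀ * |(prFA κ Φ t p D g f).vα| * ((b0TA κ Φ t p D g f 1 : ℤ) + 1)) ≤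
      (prFA κ Φ t p D g f).c₀ * (prFA κ Φ t p D g f).c₁ * (prFA κ Φ t p D g f).A *
        modulus (prFA κ Φ t p D g f).n (prFA κ Φ t p D g f).h (prFA κ Φ t p D g f).vα (prFA κ Φ t p D g f).vβ * aWTA κ Φ t p D g f := by
  obtain ⟨hA, -, hm, hc₀, hc₁, -⟩ := prFA_pos κ Φ t p D g f hN
  unfold aWTA
  exact ceil_mul_le (mul_pos (mul_pos (mul_pos hc₀ hc₁) hA) hm)

/-- **`hBx`** at `b0TA`: `D_A·(b0TA₁+1) ≤ c₁·A·BxTA`. [folklore] -/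
theorem hBx_TA (hN : EqNumL κ Φ t p D g f) :
    (prFA κ Φ t p D g f).D * ((b0TA κ Φ t p D g f 1 : ℤ) + 1) ≤ (prFA κ Φ t p D g f).c₁ * (prFA κ Φ t p D g f).A * BxTA κ Φ t p D g f := by
  obtain ⟨hA, -, -, -, hc₁, -⟩ := prFA_pos κ Φ t p D g f hN
  unfold BxTA
  exact ceil_mul_le (mul_pos hc₁ hA)

/-- **`hb`** at `b0TA`: `BxTA / U + 1 ≤ bLTA` (by `rfl`). [folklore] -/
theorem hb_TA : BxTA κ Φ t p D g f / (shearUnit (nL κ Φ t p D g f) (hL κ Φ t p D g f) : ℤ) + 1 ≤ bLTA κ Φ t p D g f := le_rfl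

/-- `0 ≤ aWTA`, `0 ≤ BxTA`, `1 ≤ bLTA`. [folklore] -/
theorem aWTA_nonneg (hN : EqNumL κ Φ t p D g f) : 0 ≤ aWTA κ Φ t p D g f ∧ 0 ≤ BxTA κ Φ t p D g f ∧ 1 ≤ bLTA κ Φ t p D g f := by
  obtain ⟨hA, hn, hm, hc₀, hc₁, hD⟩ := prFA_pos κ Φ t p D g f hN
  have hb0 : (0 : ℤ) ≤ (b0TA κ Φ t p D g f 0 : ℤ) + 1 := by have := Int.natCast_nonneg (b0TA κ Φ t p D g f 0); linarith
  have hb1 : (0 : ℤ) ≤ (b0TA κ Φ t p D g f 1 : ℤ) + 1 := by have := Int.natCast_nonneg (b0TA κ Φ t p D g f 1); linarith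
  have h0 : 0 ≤ aWTA κ Φ t p D g f := by
    unfold aWTA
    have hnum : 0 ≤ (prFA κ Φ t p D g f).D * ((prFA κ Φ t p D g f).c₁ * (prFA κ Φ t p D g f).n * ((b0TA κ Φ t p D g f 0 : ℤ) + 1) +
        (prFA κ Φ t p D g f).c₀ * |(prFA κ Φ t p D g f).vα| * ((b0TA κ Φ t p D g f 1 : ℤ) + 1)) :=
      mul_nonneg hD.le (add_nonneg (mul_nonneg (mul_nonneg hc₁.le (by linarith)) hb0) (mul_nonneg (mul_nonneg hc₀.le (abs_nonneg _)) hb1))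
    have hden : 0 ≤ (prFA κ Φ t p D g f).c₀ * (prFA κ Φ t p D g f).c₁ * (prFA κ Φ t p D g f).A *
        modulus (prFA κ Φ t p D g f).n (prFA κ Φ t p D g f).h (prFA κ Φ t p D g f).vα (prFA κ Φ t p D g f).vβ :=
      (mul_pos (mul_pos (mul_pos hc₀ hc₁) hA) hm).le
    have := Int.ediv_nonneg hnum hden
    linarith
  have h1 : 0 ≤ BxTA κ Φ t p D g f := by
    unfold BxTA
    have := Int.ediv_nonneg (mul_nonneg hD.le hb1) (mul_pos hc₁ hA).le
    linarith
  refine ⟨h0, h1, ?_⟩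
  unfold bLTA
  have hU := shearUnit_pos (one_le_of_eqNumL κ Φ t p D g f hN).1 (hL κ Φ t p D g f)
  have : 0 ≤ BxTA κ Φ t p D g f / (shearUnit (nL κ Φ t p D g f) (hL κ Φ t p D g f) : ℤ) := Int.ediv_nonneg h1 hU.le
  linarith

/-- **(P5-A)** `r_i ≤ 4·b0TA_i` and `b0TA_i ≤ 2r_i`. [folklore] -/
theorem r_le_four_b0TA (i : Fin 2) : (fcellsA κ Φ t p D g f).r i ≤ 4 * b0TA κ Φ t p D g f i ∧ b0TA κ Φ t p D g f i ≤ 2 * (fcellsA κ Φ t p D g f).r i := by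
  have hr := (fcellsA_K κ Φ t p D g f).2.2 i
  rw [b0TA_eq, hr, Neg.K_eq]
  constructor <;> nlinarith [Nat.zero_le (Neg.Kq κ * (fcellsA κ Φ t p D g f).s i)]

/-- **`hsc0/hsc1` of the (ζ′) chain** (commensurability): `c_i·A·(K·Δ) = r_i·D_A` (`c_i = 20K·s_i = A·s_i`, `r_i = K·s_i`, `D_A = A²·Δ`; today's literal `40` is `K/Kq`,
under (ζ′) the strides per `r` are `K`). [folklore] -/
theorem hsc_RA (i : Fin 2) :
    20 * ((fcellsA κ Φ t p D g f).K : ℤ) * (((fcellsA κ Φ t p D g f).s i : ℕ) : ℤ) * Aof κ *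
        ((Neg.K κ : ℤ) * modulus (nL κ Φ t p D g f) (hL κ Φ t p D g f) (vL κ Φ t p D g f) (vβL κ Φ t p D g f)) =
      ((fcellsA κ Φ t p D g f).r i : ℤ) * Skelφ.NegPrm.DofA (Aof κ) (nL κ Φ t p D g f) (hL κ Φ t p D g f) (ℓL κ Φ t p D g f) (vL κ Φ t p D g f) := by
  rw [Skelφ.NegPrm.DofA_eq, (fcellsA_K κ Φ t p D g f).2.2 i, (fcellsA_K κ Φ t p D g f).1, Aof_eq_K]
  show _ = _ * ((20 * (Neg.K κ : ℤ)) ^ 2 * modulus (nL κ Φ t p D g f) (hL κ Φ t p D g f) (vL κ Φ t p D g f) (vβL κ Φ t p D g f))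
  push_cast; ring

/-! ## §2 The sizes (P3-A), (P4-A) -/

/-- **(P3-A)** `aWTA ≤ 24·Kq·n_L` (under the numeric long clause: `|v_L| ≤ n_L`). [folklore] -/
theorem aWTA_le (hN : EqNumL κ Φ t p D g f) : aWTA κ Φ t p D g f ≤ 24 * (Neg.Kq κ : ℤ) * (nL κ Φ t p D g f : ℤ) := by
  obtain ⟨hA, hn, hm, hc₀, hc₁, hD⟩ := prFA_pos κ Φ t p D g f hN
  obtain ⟨hA', hn', -, hvα, -, hc0, hc1, hD'⟩ := prFA_fields κ Φ t p D g f
  have hv : |vL κ Φ t p D g f| ≤ nL κ Φ t p D g f := hN.v_le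
  have hK : ((fcellsA κ Φ t p D g f).K : ℤ) = Neg.K κ := by rw [(fcellsA_K κ Φ t p D g f).1]
  set pr := prFA κ Φ t p D g f
  set M := modulus pr.n pr.h pr.vα pr.vβ
  have hDM : pr.D = (Aof κ) ^ 2 * M := by
    show pr.D = (Aof κ) ^ 2 * modulus pr.n pr.h pr.vα pr.vβ
    rw [prFA_D]; unfold TwoAxis.Para.detD; rw [hA']
  set s0 := (((fcellsA κ Φ t p D g f).s 0 : ℕ) : ℤ) with hs0d
  set s1 := (((fcellsA κ Φ t p D g f).s 1 : ℕ) : ℤ) with hs1d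
  have hq : (1 : ℤ) ≤ Neg.Kq κ := by exact_mod_cast Neg.one_le_Kq κ
  have hs0 : (1 : ℤ) ≤ s0 := by rw [hs0d]; exact_mod_cast (fcellsA κ Φ t p D g f).hs 0
  have hs1 : (1 : ℤ) ≤ s1 := by rw [hs1d]; exact_mod_cast (fcellsA κ Φ t p D g f).hs 1
  have hb0 : (b0TA κ Φ t p D g f 0 : ℤ) = 10 * (Neg.Kq κ : ℤ) * s0 := by rw [hs0d, b0TA_eq]; push_cast; ring
  have hb1 : (b0TA κ Φ t p D g f 1 : ℤ) = 10 * (Neg.Kq κ : ℤ) * s1 := by rw [hs1d, b0TA_eq]; push_cast; ring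
  have ec0 : pr.c₀ = Aof κ * s0 := by rw [hc0, hK, Aof_eq_K]
  have ec1 : pr.c₁ = Aof κ * s1 := by rw [hc1, hK, Aof_eq_K]
  have hA0 : 0 < Aof κ := (Aof_pos κ).1
  have hMpos : 0 < M := hm
  have hA3 : (0 : ℤ) < (Aof κ) ^ 2 * M * Aof κ := mul_pos (mul_pos (pow_pos hA0 2) hMpos) hA0
  unfold aWTA
  have en : pr.D * (pr.c₁ * pr.n * ((b0TA κ Φ t p D g f 0 : ℤ) + 1) + pr.c₀ * |pr.vα| * ((b0TA κ Φ t p D g f 1 : ℤ) + 1)) =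
      (s1 * pr.n * (10 * (Neg.Kq κ : ℤ) * s0 + 1) + s0 * |pr.vα| * (10 * (Neg.Kq κ : ℤ) * s1 + 1)) * ((Aof κ) ^ 2 * M * Aof κ) := by
    rw [hDM, ec0, ec1, hb0, hb1]; ring
  have ed : pr.c₀ * pr.c₁ * pr.A * M = (s0 * s1) * ((Aof κ) ^ 2 * M * Aof κ) := by rw [ec0, ec1, hA']; ring
  rw [en, ed, Int.mul_ediv_mul_of_pos_left _ _ hA3]
  -- `(s1 n (10Kq s0+1) + s0 |vα| (10Kq s1+1)) / (s0 s1) ≤ 11Kq (n + |vα|) ≤ 22Kq n`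
  have h1 : 0 ≤ pr.n := by linarith
  have h2 : 0 ≤ |pr.vα| := abs_nonneg _
  have hqs0 : (1 : ℤ) ≤ (Neg.Kq κ : ℤ) * s0 := one_le_mul_of_one_le_of_one_le hq hs0
  have hqs1 : (1 : ℤ) ≤ (Neg.Kq κ : ℤ) * s1 := one_le_mul_of_one_le_of_one_le hq hs1
  have hX : s1 * pr.n * (10 * (Neg.Kq κ : ℤ) * s0 + 1) + s0 * |pr.vα| * (10 * (Neg.Kq κ : ℤ) * s1 + 1) ≤
      (11 * (Neg.Kq κ : ℤ) * pr.n + 11 * (Neg.Kq κ : ℤ) * |pr.vα|) * (s0 * s1) := by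
    have e : (11 * (Neg.Kq κ : ℤ) * pr.n + 11 * (Neg.Kq κ : ℤ) * |pr.vα|) * (s0 * s1) -
        (s1 * pr.n * (10 * (Neg.Kq κ : ℤ) * s0 + 1) + s0 * |pr.vα| * (10 * (Neg.Kq κ : ℤ) * s1 + 1)) =
        s1 * pr.n * ((Neg.Kq κ : ℤ) * s0 - 1) + s0 * |pr.vα| * ((Neg.Kq κ : ℤ) * s1 - 1) := by ring
    have t1 : 0 ≤ s1 * pr.n * ((Neg.Kq κ : ℤ) * s0 - 1) := mul_nonneg (mul_nonneg (by linarith) h1) (by linarith)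
    have t2 : 0 ≤ s0 * |pr.vα| * ((Neg.Kq κ : ℤ) * s1 - 1) := mul_nonneg (mul_nonneg (by linarith) h2) (by linarith)
    linarith
  have hss : 0 < s0 * s1 := mul_pos (by linarith) (by linarith)
  have hdiv := Int.ediv_le_of_le_mul hss hX
  have hv' : |pr.vα| ≤ pr.n := by rw [hvα, hn']; exact hv
  rw [← hn']
  have hqv : (Neg.Kq κ : ℤ) * |pr.vα| ≤ (Neg.Kq κ : ℤ) * pr.n := mul_le_mul_of_nonneg_left hv' (by linarith)
  have hn1' : (1 : ℤ) ≤ pr.n := by rw [hn']; exact_mod_cast (one_le_of_eqNumL κ Φ t p D g f hN).1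
  have hqn : (1 : ℤ) ≤ (Neg.Kq κ : ℤ) * pr.n := one_le_mul_of_one_le_of_one_le hq hn1'
  linarith

/-- **(P4-A)** `U·(bLTA + 1) ≤ 12·Kq·Δ` (`BxTA ≤ 11·Kq·Δ + 1`, `U(Bx/U + 2) ≤ Bx + 2U`, `2U + 1 ≤ Δ ≤ Kq·Δ`). [folklore] -/
theorem U_bLTA_le (hN : EqNumL κ Φ t p D g f) (hκ : (hL κ Φ t p D g f).natAbs ≤ 10 * nL κ Φ t p D g f) (hℓ : 24 ≤ ℓL κ Φ t p D g f) :
    (shearUnit (nL κ Φ t p D g f) (hL κ Φ t p D g f) : ℤ) * (bLTA κ Φ t p D g f + 1) ≤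
      12 * (Neg.Kq κ : ℤ) * modulus (nL κ Φ t p D g f) (hL κ Φ t p D g f) (vL κ Φ t p D g f) (vβL κ Φ t p D g f) := by
  obtain ⟨hA, hn, hm, hc₀, hc₁, hD⟩ := prFA_pos κ Φ t p D g f hN
  obtain ⟨hA', hn', hh', hvα, hvβ, hc0, hc1, -⟩ := prFA_fields κ Φ t p D g f
  obtain ⟨hn1, hℓ1⟩ := one_le_of_eqNumL κ Φ t p D g f hN
  have hU := shearUnit_pos hn1 (hL κ Φ t p D g f)
  have hK : ((fcellsA κ Φ t p D g f).K : ℤ) = Neg.K κ := by rw [(fcellsA_K κ Φ t p D g f).1]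
  set pr := prFA κ Φ t p D g f
  set M := modulus (nL κ Φ t p D g f) (hL κ Φ t p D g f) (vL κ Φ t p D g f) (vβL κ Φ t p D g f)
  have hM' : modulus pr.n pr.h pr.vα pr.vβ = M := by rw [hn', hh', hvα, hvβ]
  have hMpos : 0 < M := by rw [← hM']; exact hm
  have hDM : pr.D = (Aof κ) ^ 2 * M := by rw [prFA_D]; unfold TwoAxis.Para.detD; rw [hA', hM']
  set s1 := (((fcellsA κ Φ t p D g f).s 1 : ℕ) : ℤ) with hs1d
  have hq : (1 : ℤ) ≤ Neg.Kq κ := by exact_mod_cast Neg.one_le_Kq κ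
  have hs1 : (1 : ℤ) ≤ s1 := by rw [hs1d]; exact_mod_cast (fcellsA κ Φ t p D g f).hs 1
  have hb1 : (b0TA κ Φ t p D g f 1 : ℤ) = 10 * (Neg.Kq κ : ℤ) * s1 := by rw [hs1d, b0TA_eq]; push_cast; ring
  have ec1 : pr.c₁ = Aof κ * s1 := by rw [hc1, hK, Aof_eq_K]
  have hA0 : 0 < Aof κ := (Aof_pos κ).1
  have hA2 : (0 : ℤ) < Aof κ * Aof κ := mul_pos hA0 hA0
  -- `BxTA = ⌊M(10Kq s1+1)/s1⌋ + 1 ≤ 11 Kq M + 1`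
  have hBx : BxTA κ Φ t p D g f ≤ 11 * (Neg.Kq κ : ℤ) * M + 1 := by
    unfold BxTA
    rw [hDM, ec1, hA', hb1, show (Aof κ) ^ 2 * M * (10 * (Neg.Kq κ : ℤ) * s1 + 1) = (M * (10 * (Neg.Kq κ : ℤ) * s1 + 1)) * (Aof κ * Aof κ) by ring,
      show Aof κ * s1 * Aof κ = s1 * (Aof κ * Aof κ) by ring, Int.mul_ediv_mul_of_pos_left _ _ hA2]
    have hX : M * (10 * (Neg.Kq κ : ℤ) * s1 + 1) ≤ (11 * (Neg.Kq κ : ℤ) * M) * s1 := by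
      have hqs1 : (1 : ℤ) ≤ (Neg.Kq κ : ℤ) * s1 := one_le_mul_of_one_le_of_one_le hq hs1
      have t : M * 1 ≤ M * ((Neg.Kq κ : ℤ) * s1) := mul_le_mul_of_nonneg_left hqs1 hMpos.le
      have e : (11 * (Neg.Kq κ : ℤ) * M) * s1 - M * (10 * (Neg.Kq κ : ℤ) * s1 + 1) = M * ((Neg.Kq κ : ℤ) * s1) - M * 1 := by ring
      linarith
    have := Int.ediv_le_of_le_mul (by linarith : 0 < s1) hX
    linarith
  have h1 : (shearUnit (nL κ Φ t p D g f) (hL κ Φ t p D g f) : ℤ) * (BxTA κ Φ t p D g f / (shearUnit (nL κ Φ t p D g f) (hL κ Φ t p D g f) : ℤ)) ≤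
      BxTA κ Φ t p D g f := Int.mul_ediv_self_le hU.ne'
  have e : (shearUnit (nL κ Φ t p D g f) (hL κ Φ t p D g f) : ℤ) * (bLTA κ Φ t p D g f + 1) =
      (shearUnit (nL κ Φ t p D g f) (hL κ Φ t p D g f) : ℤ) * (BxTA κ Φ t p D g f / (shearUnit (nL κ Φ t p D g f) (hL κ Φ t p D g f) : ℤ)) +
        2 * (shearUnit (nL κ Φ t p D g f) (hL κ Φ t p D g f) : ℤ) := by unfold bLTA; ring
  rw [e]
  -- `2U + 1 ≤ M ≤ Kq·M`
  have hUle : (shearUnit (nL κ Φ t p D g f) (hL κ Φ t p D g f) : ℤ) ≤ 11 * (nL κ Φ t p D g f : ℤ) := by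
    unfold Skelφ.shearUnit; push_cast
    have : ((hL κ Φ t p D g f).natAbs : ℤ) ≤ 10 * (nL κ Φ t p D g f : ℤ) := by exact_mod_cast hκ
    linarith
  have hmlo := (Skelφ.NegPrm.modulus_vβOf hn1 (hL κ Φ t p D g f) (ℓL κ Φ t p D g f) (vL κ Φ t p D g f)).1
  have eβ : vβL κ Φ t p D g f = Skelφ.NegPrm.vβOf (nL κ Φ t p D g f) (hL κ Φ t p D g f) (ℓL κ Φ t p D g f) (vL κ Φ t p D g f) := rfl
  rw [← eβ] at hmlo
  have hℓ' : (24 : ℤ) ≤ ℓL κ Φ t p D g f := by exact_mod_cast hℓ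
  have hn0 : (0 : ℤ) ≤ nL κ Φ t p D g f := by positivity
  have h23 : 23 * (nL κ Φ t p D g f : ℤ) ≤ M := by
    have t : (nL κ Φ t p D g f : ℤ) * 24 ≤ (nL κ Φ t p D g f : ℤ) * ℓL κ Φ t p D g f := mul_le_mul_of_nonneg_left hℓ' hn0
    linarith
  have hMK : M ≤ (Neg.Kq κ : ℤ) * M := by
    have t : M * 1 ≤ M * (Neg.Kq κ : ℤ) := mul_le_mul_of_nonneg_left hq hMpos.le
    linarith
  have hn1' : (1 : ℤ) ≤ nL κ Φ t p D g f := by exact_mod_cast hn1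
  linarith

end Values

end NegB

end PlanarSkeletonNeg

end Summit.CriticalPhenomena.PercolationContinuityZ3.Theorems.Transplant

end
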